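import Literature.Computability.Complexity.TruthTableClosure
import Literature.Computability.Complexity.StackBricks
import Literature.Computability.Complexity.MajorityEnumeration
import Literature.Computability.Complexity.CoinTruncation
import Literature.Computability.Complexity.CountingProofs
import HarnessLib

/-!
# Threshold languages of witness counts are in `PP` (the oracle of `P^{#P} = P^{PP}`)

Topic `Computability/Complexity` (counting classes). For a witness language `V ∈ P` and a witness
length polynomial `r`, the **threshold language**

  `TLang V r = {⟨x, ⟨t, ν⟩⟩ | val(ν) < #{w ∈ {0,1}^{r(|x|)} | ⟨⟨x, t⟩, w⟩ ∈ V}}`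

(`val` = `bitsToNat`, little-endian; `t` is a tag the witness language may read, so that several
counting functions of `x` share one oracle) is in `PP` (`TLang_mem_PP`). This is the oracle through
which a polynomial-time machine recovers a `#P` value exactly by binary search — Arora–Barak 2009,
§17.2.1, proof of Lemma 17.7 (`PP = P ⇔ #P = FP`, by binary search on thresholds `N`): comparing a
`#P` function with a threshold written on the input is a `PP` question. (That `P^{#P} = P^{PP}`
follows is folklore from this proof together with `PP ⊆ P^{#P}`, `PPSharpP` in `CountingProofs.lean`;
Arora–Barak do not print it as a numbered statement.)

Construction (`majLang`, the `P` witness language of the majority vote, coin strings `u = b·r'` of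
length `B + 1`, `B = r(L) + L` for input length `L`, so `B ≥ r(|x|)` and `B ≥ |ν|`):
* `b = 1`: accept iff `r' = w 0^{B − r(|x|)}` with `⟨⟨x, t⟩, w⟩ ∈ V` — exactly `#V(x, t)` strings
  (`cnt_take_mem_of_drop_zero`);
* `b = 0`: accept iff `val(r') ≥ val(ν)` — exactly `2^B − val(ν)` strings (`cnt_ge`), as
  `val(ν) < 2^{|ν|} ≤ 2^B`;
so the accepted coin strings are a strict majority of the `2^{B+1}` iff `#V(x, t) > val(ν)`
(`mem_TLang_iff`, `TLang_mem_PP`). Gill's strict threshold `> 1/2` of the tree's `PP = pMajority P`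
is used as is (`half_lt_uniformProb_iff`).

## References

* S. Arora, B. Barak, *Computational Complexity: A Modern Approach*, CUP 2009, §17.2.1 (the class
  `PP`; Lemma 17.7 and its proof: binary search with `PP` questions on a threshold `N`).
* J. Gill, *Computational complexity of probabilistic Turing machines*, SIAM J. Comput. 6 (1977)
  675–695, Def. 5.1 (`PP`).
-/

namespace Literature.Computability.Complexity

open _root_.Computability Polynomial PRelSigma OracleCompose TTClosure Brick CoinEnum PPSharpP

namespace ThresholdPP

variable (V : Language Bool) (r : Polynomial ℕ)

/-! ### The threshold language -/

/-- `cntV V r x t = #{w ∈ {0,1}^{r(|x|)} | ⟨⟨x, t⟩, w⟩ ∈ V}`: the witness count of the tagged input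
`⟨x, t⟩` at witness length `r(|x|)`. (Arora–Barak 2009, Def. 17.2.) [cite: AroraBarak2009, Def. 17.2] -/
noncomputable def cntV (x t : List Bool) : ℕ := countWitnesses V (r.eval x.length) (boolPair x t)

/-- **The threshold language** `TLang V r = {⟨x, ⟨t, ν⟩⟩ | bitsToNat ν < cntV V r x t}` (read
through the total projections `fstP`/`sndP`). (Arora–Barak 2009, §17.2.1, proof of Lemma 17.7:
the `PP` questions of the binary search.) [cite: AroraBarak2009, Lemma 17.7 (proof)] -/
def TLang : Language Bool :=
  {z | bitsToNat (sndP (sndP z)) < cntV V r (fstP z) (fstP (sndP z))}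

variable {V r} in
/-- Membership of a well-formed triple in `TLang`. [cite: AroraBarak2009, Lemma 17.7 (proof)] -/
@[simp] theorem mem_TLang_iff (x t ν : List Bool) :
    boolPair x (boolPair t ν) ∈ TLang V r ↔ bitsToNat ν < cntV V r x t := by
  change bitsToNat (sndP (sndP (boolPair x (boolPair t ν)))) <
    cntV V r (fstP (boolPair x (boolPair t ν))) (fstP (sndP (boolPair x (boolPair t ν)))) ↔ _
  simp

/-! ### The witness language of the majority vote -/

/-- The coin polynomial `U = r + X + 1` (`B = U − 1 = r(L) + L`). [folklore] -/
noncomputable def UP : Polynomial ℕ := r + X + 1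

/-- `U(L) = r(L) + L + 1`. [folklore] -/
@[simp] theorem eval_UP (L : ℕ) : (UP r).eval L = r.eval L + L + 1 := by simp [UP]

/-- `x` read off `⟨⟨x, ⟨t, ν⟩⟩, u⟩`. [folklore] -/
def xF : List Bool → List Bool := fstP ∘ fstP
/-- `t` read off `⟨⟨x, ⟨t, ν⟩⟩, u⟩`. [folklore] -/
def tF : List Bool → List Bool := fstP ∘ sndP ∘ fstP
/-- `ν` read off `⟨⟨x, ⟨t, ν⟩⟩, u⟩`. [folklore] -/
def nuF : List Bool → List Bool := sndP ∘ sndP ∘ fstP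
/-- The coins past the branch bit, `r' = tail u`. [folklore] -/
def rF : List Bool → List Bool := List.tail ∘ sndP
/-- The candidate witness `r' ↾ r(|x|)`. [folklore] -/
noncomputable def wF : List Bool → List Bool := sndP ∘ truncSndFn r ∘ pairFn xF rF
/-- The padding `r' ⇂ r(|x|)`. [folklore] -/
noncomputable def padF : List Bool → List Bool := sndP ∘ dropSndFn r ∘ pairFn xF rF

/-- **The `P` witness language of the majority vote** on `⟨⟨x, ⟨t, ν⟩⟩, u⟩`, `u = b·r'`:
`b = 1 ∧ ⟨⟨x, t⟩, r' ↾ r|x|⟩ ∈ V ∧ r' ⇂ r|x| ∈ 0*`, or `b = 0 ∧ ¬ val(r') < val(ν)`.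
[cite: AroraBarak2009, Lemma 17.7 (proof)] -/
def majLang : Language Bool :=
  ((sndP ⁻¹' HeadIs true) ⊓ (pairFn (pairFn xF tF) (wF r) ⁻¹' V) ⊓ (padF r ⁻¹' NoBit true)) ⊔
    ((sndP ⁻¹' HeadIs false) ⊓ ((ltFn ∘ pairFn rF nuF) ⁻¹' HeadIs false))

variable {V r}

/-- The accessors are in `FP`. [folklore] -/
theorem accessors_mem_FP : xF ∈ FP ∧ tF ∈ FP ∧ nuF ∈ FP ∧ rF ∈ FP ∧ wF r ∈ FP ∧ padF r ∈ FP := by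
  have hx : xF ∈ FP := comp_mem_FP fstP_mem_FP fstP_mem_FP
  have hr : rF ∈ FP := comp_mem_FP tail_mem_FP sndP_mem_FP
  exact ⟨hx, comp_mem_FP fstP_mem_FP (comp_mem_FP sndP_mem_FP fstP_mem_FP),
    comp_mem_FP sndP_mem_FP (comp_mem_FP sndP_mem_FP fstP_mem_FP), hr,
    comp_mem_FP sndP_mem_FP (comp_mem_FP (truncSndFn_mem_FP r) (pairFn_mem_FP hx hr)),
    comp_mem_FP sndP_mem_FP (comp_mem_FP (dropSndFn_mem_FP r) (pairFn_mem_FP hx hr))⟩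

/-- **`majLang V r ∈ P`** for `V ∈ P`. [cite: AroraBarak2009, Lemma 17.7 (proof)] -/
theorem majLang_mem_P (hV : V ∈ Classes.P) : majLang V r ∈ Classes.P := by
  obtain ⟨hx, ht, hν, hr, hw, hp⟩ := accessors_mem_FP (r := r)
  exact union_mem_P
    (inter_mem_P (inter_mem_P (preimage_mem_P (HeadIs_mem_P true) sndP_mem_FP)
      (preimage_mem_P hV (pairFn_mem_FP (pairFn_mem_FP hx ht) hw))) (preimage_mem_P (NoBit_mem_P true) hp))
    (inter_mem_P (preimage_mem_P (HeadIs_mem_P false) sndP_mem_FP)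
      (preimage_mem_P (HeadIs_mem_P false) (comp_mem_FP ltFn_mem_FP (pairFn_mem_FP hr hν))))

/-- Membership in an intersection of languages (definitional; the `⊔` form is `PPSharpP.memL_sup`,
`CountingProofs.lean`; the `⊓` form exists only downstream, `StockMachine.memL_inf`). [folklore] -/
theorem memL_inf' {L₁ L₂ : Language Bool} {w : List Bool} :
    @Membership.mem (List Bool) (Language Bool) _ (L₁ ⊓ L₂) w ↔ w ∈ L₁ ∧ w ∈ L₂ := Iff.rfl

/-- A string avoids `1` iff it is the all-zero string of its length. [folklore] -/
theorem true_not_mem_iff (l : List Bool) : true ∉ l ↔ l = List.replicate l.length false := by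
  constructor
  · intro h
    exact List.eq_replicate_iff.2 ⟨rfl, fun b hb => by
      cases b
      · rfl
      · exact absurd hb h⟩
  · intro h hmem
    rw [h] at hmem
    exact Bool.noConfusion (List.eq_of_mem_replicate hmem)

/-- **Semantics of `majLang` on the branch `b = 1`** (for an arbitrary input string `z`, read as
`x = fstP z`, `t = fstP (sndP z)`): the candidate is a witness and the padding is zero.
[cite: AroraBarak2009, Lemma 17.7 (proof)] -/
theorem mem_majLang_true (z r' : List Bool) :
    boolPair z (true :: r') ∈ majLang V r ↔
      boolPair (boolPair (fstP z) (fstP (sndP z))) (r'.take (r.eval (fstP z).length)) ∈ V ∧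
        r'.drop (r.eval (fstP z).length) = List.replicate (r'.length - r.eval (fstP z).length) false := by
  simp only [majLang, memL_sup, memL_inf', memL_preimage, sndP_boolPair, mem_HeadIs, List.head?_cons,
    Option.some.injEq, true_and, Bool.true_eq_false, false_and, or_false, pairFn_apply, xF, tF, wF, padF, rF,
    Function.comp_apply, fstP_boolPair, List.tail_cons, truncSndFn_boolPair, dropSndFn_boolPair, mem_NoBit,
    true_not_mem_iff, List.length_drop]

/-- **Semantics of `majLang` on the branch `b = 0`** (`ν = sndP (sndP z)`): `val(r') ≥ val(ν)`.
[cite: AroraBarak2009, Lemma 17.7 (proof)] -/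
theorem mem_majLang_false (z r' : List Bool) :
    boolPair z (false :: r') ∈ majLang V r ↔ bitsToNat (sndP (sndP z)) ≤ bitsToNat r' := by
  simp only [majLang, memL_sup, memL_inf', memL_preimage, sndP_boolPair, mem_HeadIs, List.head?_cons,
    Option.some.injEq, Bool.false_eq_true, false_and, false_or, true_and, Function.comp_apply, pairFn_apply,
    rF, nuF, List.tail_cons, fstP_boolPair, ltFn_boolPair, decide_eq_false_iff_not, not_lt]

/-! ### Counting the accepted coin strings -/

/-- **Padding does not change a count**: among the strings of length `B ≥ k`, those whose prefix of
length `k` lies in `E` and whose remaining `B − k` symbols are `0` are as many as the strings of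
length `k` in `E`. [folklore] -/
theorem cnt_take_mem_of_drop_zero (E : Set (List Bool)) {k B : ℕ} (hkB : k ≤ B) :
    cnt B {r' | r'.take k ∈ E ∧ r'.drop k = List.replicate (r'.length - k) false} = cnt k E := by
  classical
  unfold cnt
  refine Finset.card_bij' (fun v _ => ⟨v.toList.take k, by simp; omega⟩)
    (fun w _ => ⟨w.toList ++ List.replicate (B - k) false, by simp; omega⟩) ?_ ?_ ?_ ?_
  · intro v hv
    simp only [Finset.mem_filter, Finset.mem_univ, true_and, Set.mem_setOf_eq] at hv ⊢
    exact hv.1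
  · intro w hw
    simp only [Finset.mem_filter, Finset.mem_univ, true_and, Set.mem_setOf_eq, List.Vector.toList_mk] at hw ⊢
    have hl : w.toList.length = k := by simp
    refine ⟨?_, ?_⟩
    · rw [List.take_append_of_le_length (le_of_eq hl.symm), List.take_of_length_le (le_of_eq hl)]
      exact hw
    · rw [List.drop_append_of_le_length (le_of_eq hl.symm), List.drop_of_length_le (le_of_eq hl)]
      simp
  · intro v hv
    simp only [Finset.mem_filter, Finset.mem_univ, true_and, Set.mem_setOf_eq] at hv
    apply List.Vector.toList_injective
    simp only [List.Vector.toList_mk]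
    have h := List.take_append_drop k v.toList
    rw [hv.2] at h
    simpa using h
  · intro w _
    apply List.Vector.toList_injective
    have hl : w.toList.length = k := by simp
    simp only [List.Vector.toList_mk]
    rw [List.take_append_of_le_length (le_of_eq hl.symm), List.take_of_length_le (le_of_eq hl)]

/-- **Counting the numerals above a threshold**: among the strings of length `B`, exactly
`2^B − θ` have value `≥ θ` (truncated subtraction: none if `θ > 2^B`). [folklore] -/
theorem cnt_ge (B θ : ℕ) : cnt B {r' | θ ≤ bitsToNat r'} = 2 ^ B - θ := by
  classical
  rw [← CoinEnum.sum_range_ite_natBits]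
  have h : ∀ i ∈ Finset.range (2 ^ B), (if natBits B i ∈ {r' : List Bool | θ ≤ bitsToNat r'} then 1 else 0) =
      if θ ≤ i then 1 else 0 := fun i hi => by
    simp only [Set.mem_setOf_eq, bitsToNat_natBits (Finset.mem_range.1 hi)]
  rw [Finset.sum_congr rfl h, Finset.sum_boole]
  simp only [Nat.cast_id]
  rw [show (Finset.range (2 ^ B)).filter (fun i => θ ≤ i) = Finset.Ico θ (2 ^ B) by
    ext i; simp [Finset.mem_Ico, and_comm]]
  exact Nat.card_Ico θ (2 ^ B)

/-- **The number of accepted coin strings** on an input `z` (`x = fstP z`, `t = fstP (sndP z)`,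
`ν = sndP (sndP z)`) with `B ≥ r(|x|)`: `#V(x, t) + (2^B − val(ν))` (truncated subtraction).
[cite: AroraBarak2009, Lemma 17.7 (proof)] -/
theorem cnt_majLang (z : List Bool) {B : ℕ} (hB : r.eval (fstP z).length ≤ B) :
    cnt (B + 1) {u | boolPair z u ∈ majLang V r} =
      cntV V r (fstP z) (fstP (sndP z)) + (2 ^ B - bitsToNat (sndP (sndP z))) := by
  rw [cnt_succ, add_comm]
  congr 1
  · rw [show {y : List Bool | true :: y ∈ {u : List Bool | boolPair z u ∈ majLang V r}} =
        {r' | r'.take (r.eval (fstP z).length) ∈ {w : List Bool | boolPair (boolPair (fstP z) (fstP (sndP z))) w ∈ V} ∧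
          r'.drop (r.eval (fstP z).length) = List.replicate (r'.length - r.eval (fstP z).length) false} from
      Set.ext fun r' => by simp only [Set.mem_setOf_eq, mem_majLang_true], cnt_take_mem_of_drop_zero _ hB]
    rfl
  · rw [show {y : List Bool | false :: y ∈ {u : List Bool | boolPair z u ∈ majLang V r}} =
        {r' | bitsToNat (sndP (sndP z)) ≤ bitsToNat r'} from Set.ext fun r' => by
          simp only [Set.mem_setOf_eq, mem_majLang_false]]
    exact cnt_ge _ _

/-! ### `TLang ∈ PP` -/

/-- **Threshold languages of witness counts are in `PP`.** For `V ∈ P`: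
`{⟨x, ⟨t, ν⟩⟩ | val(ν) < #V(x, t)} ∈ PP`, by the majority vote `majLang` over `B + 1` coins,
`B = r(L) + L`. (Arora–Barak 2009, §17.2.1 with the proof of Lemma 17.7.) [cite: AroraBarak2009, Lemma 17.7 (proof)] -/
theorem TLang_mem_PP (hV : V ∈ Classes.P) : TLang V r ∈ PP := by
  refine ⟨majLang V r, majLang_mem_P hV, UP r, fun z => ?_⟩
  rw [half_lt_uniformProb_iff, eval_UP]
  have h1 : 2 * (fstP z).length + (sndP z).length ≤ z.length := length_fstF_sndF_le z
  have h2 : 2 * (fstP (sndP z)).length + (sndP (sndP z)).length ≤ (sndP z).length := length_fstF_sndF_le (sndP z)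
  have hB1 : r.eval (fstP z).length ≤ r.eval z.length + z.length :=
    (TM2Iter.eval_mono r (by omega)).trans (Nat.le_add_right _ _)
  have hB2 : (sndP (sndP z)).length ≤ r.eval z.length + z.length := by omega
  rw [cnt_majLang (V := V) (r := r) z hB1]
  have hν : bitsToNat (sndP (sndP z)) ≤ 2 ^ (r.eval z.length + z.length) :=
    (bitsToNat_lt _).le.trans (Nat.pow_le_pow_right two_pos hB2)
  change bitsToNat (sndP (sndP z)) < cntV V r (fstP z) (fstP (sndP z)) ↔ _
  rw [pow_succ]
  omega

end ThresholdPP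

end Literature.Computability.Complexity
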